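import Summits.Langlands.Langlands.Theorems.IrreducibilityBySelfDualityRegularTwistFromHalfIntegralSMO
import Summits.Langlands.Langlands.Theorems.IrreducibilityBySelfDualityHalfIntegralTwistCM
import Summits.Langlands.Langlands.Theorems.IrreducibilityBySelfDualityRegularTwistCMPairingCore
import Summits.Langlands.Langlands.Theorems.IrreducibilityBySelfDualityRegularTwistCMComplexFactorCasimir
import Summits.Langlands.Langlands.Theorems.IrreducibilityBySelfDualityRegularTwistCMCompactPlaceIntegrality
import Summits.Langlands.Langlands.Theorems.IrreducibilityBySelfDualityRegularTwistCMInfinityTypeOfLocalPairing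
import Summits.Langlands.Langlands.Theorems.IrreducibilityBySelfDualityRegularTwistCMLocalPairingTransfer
import Literature.NumberTheory.Automorphic.AutomorphicRepInfinitesimalCharacter
import HarnessLib

/-!
# Crux `RegularTwistCM` (stmt-Langlands-14069) — line `petersson-hermitian-purity`, lead skeleton r4

The crux `RegularTwistCM` (route `IrreducibilityBySelfDuality`, rank 3) is, after the landed glue
`RegularTwistFromHalfIntegral_of_GJ_smo_infinityType` (item stmt-Langlands-14726) and the PROVED lever
`HalfIntegralTwistCM` (stmt-Langlands-14036, `HalfIntegralTwistCM.TwoPrimaryChevalleyCore.HalfIntegralTwistCM_proof`),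
EXACTLY the conjunction of three archimedean inputs:

* INPUT A `stub_gelbartJacquetArchimedean` = the named fact `GelbartJacquet_adjoint_lift_archimedean`
  (Gelbart–Jacquet 1978, Thm. 9.3 with its archimedean clause) — printed input, not attacked by this line;
* INPUT B `stub_smoSpherical` = `strong_multiplicity_one_gl_sphericalLevel 3 K` for every `K`
  (Jacquet–Shalika 1981 II, Thm. 4.4) — printed input, not attacked by this line;
* the INTEGRAL PAIRING `AutomorphicRepData.exists_hasInfinityType` for rank-2 data (Clozel 1990, §3.3:
  at a complex place the Harish-Chandra parameters `{s₁, s₂}` at `ι` and `{t₁, t₂}` at `ῑ` pair with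
  `s_i - t_j ∈ ℤ`), which this line PROVES from the tree's `(𝔤, K)`-module structure of `W / W'`, cut into
  four stubs + one transfer stub:
  - C1 `stub_pairingCore` — pure algebra: two commuting `𝔤𝔩₂(ℂ)`-actions `L`, `R` with Casimir/centre
    scalars, the twisted diagonal `D(Y) = L(Y) - R(Yᵀ)` locally finite with integral torus eigenvalues ⟹ an
    integral pairing (step-down operator on a `D`-primitive vector of minimal weight:
    `p z₋ v = -¼ (m² - (a+b)²)(m² - (a-b)²) v`, Naimark's bottom-`K`-type relation);
  - C2 `stub_complexFactorCasimir` — the complex-place dictionary: a real `𝔤𝔩₂(ℂ)`-module with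
    `HasHCParameter χ` factors as `ρ X = L X + R X̄` with `L 1 = s₁ + s₂`, `C_L = s₁² + s₂² - ½`
    (`χ id = {s₁, s₂}`) and the same for `R`, `χ conj` (Knapp 2002, Thm. 5.44, at `𝕜 = ℂ`, `n = 2`);
  - C3 `stub_compactPlaceIntegrality` — `u(n)`-finiteness and integrality of the torus weights at a complex
    place of ANY automorphic `GL_n` datum (`isGKModule_of_hasLieAction_holds` + `GKModulesOneParameter`);
  - C4 `stub_infinityTypeOfLocalPairing` — bookkeeping: local pairings at the complex places ⟹
    `exists_hasInfinityType` (real places pair trivially);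
  - T  `stub_localPairingTransfer` — C1 → C2 → C3 → the local pairing of a rank-2 datum at a complex place.

`RegularTwistCM_of` concludes the crux BY NAME. State (lead c1, 2026-08-16T14:05Z): C1, C2, C3, C4, T are LANDED
theorems of the tree and so are `exists_hasInfinityType_gl_two` + `regularTwistCM_of_GJ_smo`
(`…RegularTwistCMModuloInputs.lean`, p105586); the only `sorry`s left are the two printed inputs A and B.
-/

set_option linter.dupNamespace false

noncomputable section

open scoped ComplexConjugate Classical Matrix
open NumberField NumberField.InfinitePlace NumberField.mixedEmbedding Filter
open Literature.NumberTheory.Automorphic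

namespace Summit.Langlands.Langlands.Theorems.RegularTwistCM

/-! ## The two printed inputs -/

/-- INPUT A (printed; Gelbart–Jacquet 1978, Thm. (9.3) with its archimedean clause): the named fact
`GelbartJacquet_adjoint_lift_archimedean` of the tree.  NOTE (rchoice planner, rev 17, 2026-08-16T13:39Z): this input
is being promoted to the route crux `GelbartJacquetLiftArchimedean` (item stmt-Langlands-15002, `rfl`-equal to the named
fact) with glue `RegularTwistFromArchimedean` (stmt-Langlands-15018); once the route file materialises rev 17, re-point
this stub at `Summit.Langlands.Langlands.Theses.IrreducibilityBySelfDuality.GelbartJacquetLiftArchimedean` BY NAME (one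
line; `RegularTwistCM_of` is unchanged by `δ`). [cite: GelbartJacquet1978, Thm. (9.3)] -/
theorem stub_gelbartJacquetArchimedean : GelbartJacquet_adjoint_lift_archimedean := by
  sorry

/-- INPUT B (printed; Jacquet–Shalika 1981 II, Thm. 4.4): strong multiplicity one for `GL₃` in the
tree's spherical-level form, for every number field. [cite: JacquetShalikaAJM1981II, Thm. 4.4] -/
theorem stub_smoSpherical :
    ∀ (K : Type) [Field K] [NumberField K], strong_multiplicity_one_gl_sphericalLevel 3 K := by
  sorry

/-! ## The integral pairing, cut into stubs — all LANDED -/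

-- C1 `stub_pairingCore` LANDED: p102288 (…RegularTwistCMPairingCore.lean), imported.

-- C2 `stub_complexFactorCasimir` LANDED: p103340 (…RegularTwistCMComplexFactorCasimir.lean) + Literature p102424, imported.
-- C3 `stub_compactPlaceIntegrality` LANDED: p99005 (…RegularTwistCMCompactPlaceIntegrality.lean), imported.
-- C4 `stub_infinityTypeOfLocalPairing` LANDED: p98405 (…RegularTwistCMInfinityTypeOfLocalPairing.lean), imported.

-- T `stub_localPairingTransfer` LANDED: p101339 (…RegularTwistCMLocalPairingTransfer.lean), imported.

/-! ## Composition -/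

-- The same two theorems are LANDED (Theses-free) as `exists_hasInfinityType_gl_two` / `regularTwistCM_of_GJ_smo` in
-- `…RegularTwistCMModuloInputs.lean` (p105586); this workfile keeps its own copy of the composition so that it
-- elaborates against the already-built stub modules.

/-- **Every automorphic representation datum on `GL₂(𝔸_K)` has an infinity type** (the named fact
`AutomorphicRepData.exists_hasInfinityType` at `n = 2`, from the LANDED stubs C1–C4 and T and the PROVED existence
of an archimedean parameter `exists_hasArchParameter_gl`). Clozel 1990, §3.3. [cite: Clozel1990, §3.3] -/
theorem exists_hasInfinityType_gl_two_skel {K : Type} [Field K] [NumberField K]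
    {hcpt : isCompact_glFiniteIntegralLevel 2 K} (π : AutomorphicRepData (AutomorphyDatum.gl 2 K hcpt)) :
    π.exists_hasInfinityType := by
  obtain ⟨χ, hχ⟩ := π.exists_hasArchParameter_gl
  refine stub_infinityTypeOfLocalPairing π χ hχ fun w => ?_
  exact stub_localPairingTransfer
    (fun L R hLR s₁ s₂ t₁ t₂ hZL hCL hZR hCR hfin hint =>
      stub_pairingCore L R hLR s₁ s₂ t₁ t₂ hZL hCL hZR hCR hfin hint)
    (fun ρ χ' hχ' => stub_complexFactorCasimir ρ χ' hχ')
    (fun π' _ hρ' w' => stub_compactPlaceIntegrality π' hρ' w')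
    π χ hχ w

/-- **The crux `RegularTwistCM` from the stubs** (BY NAME): the landed glue
`RegularTwistFromHalfIntegral_of_GJ_smo_infinityType` (inputs A, B and the rank-2 infinity type) applied to the
PROVED lever `HalfIntegralTwistCM_proof`. [cite: Patrikis2019, Prop. 1.3.1] -/
theorem RegularTwistCM_of :
    Summit.Langlands.Langlands.Theses.IrreducibilityBySelfDuality.RegularTwistCM :=
  RegularTwistFromHalfIntegral_of_GJ_smo_infinityType stub_gelbartJacquetArchimedean stub_smoSpherical
    (fun _K _ _ _hcpt₂ σ₀ => exists_hasInfinityType_gl_two_skel σ₀.1)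
    HalfIntegralTwistCM.TwoPrimaryChevalleyCore.HalfIntegralTwistCM_proof

end Summit.Langlands.Langlands.Theorems.RegularTwistCM

end
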